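import Literature.Geometry.Lorentzian.TeukolskyModeStabilityNonpos
import Literature.Geometry.Lorentzian.TeukolskyStarobinskyHeun
import HarnessLib

/-!
# Real-axis mode stability for the Teukolsky equation on subextremal Kerr — the discharge of
# the named fact (Teixeira da Costa 2020, Theorem 4.1, `|a| < M`)

This file proves `Literature.Geometry.Lorentzian.Kerr.Costa2019_realAxisModeStability`
(`TeukolskyRealAxisModeStability.lean`; R. Teixeira da Costa, *Mode stability for the Teukolsky
equation on extremal and subextremal Kerr spacetimes*, Commun. Math. Phys. 378 (2020) 705–781 =
arXiv:1910.02854 [Costa2019], Theorem 4.1, subextremal case) by the printed case distinction of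
§4: for `s ≤ 0` the Whiting–Shlapentokh-Rothman integral transformation, the conserved
`T`-current and the unique continuation lemma (`Costa2019.modeStability_nonpos`, §4.2 with
Prop. 3.8 and Lemma 4.1); for `s > 0` the reduction to spin `−s` by the radial
Teukolsky–Starobinsky identities (`Costa2019.modeStability_pos_of_nonpos`, §4.3 with Prop. 2.14 /
Lemma 2.19), the spin `−s < 0` case being again `modeStability_nonpos` (with the angular
parameter `λ + 2s`, which the fact allows since `λ` is arbitrary). The whole programme
(`TeukolskyRealAxisModeStabilityProofs.lean`, `TeukolskyRadialHeunForm.lean`,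
`TeukolskyWhitingOperator.lean`, `…Kernel`, `…Transform`, `…TransformODE`,
`…PotentialHorizon`, `…Endgame`, `OscillatoryHalfLine.lean`, `FarFieldODEChain.lean`,
`InverseSmoothAmplitudes.lean`, `TeukolskyOutgoingExpansion.lean`, `ErdelyiEndpoint.lean`,
`…FarField`, `…RealAxis`, `RegularSingularVanishing.lean`, `TeukolskyHorizonVanishing.lean`,
`TeukolskyModeStabilityNonpos.lean`, `TeukolskyStarobinskyHeun.lean`) is fully proved and
introduces no named facts (D-0026).

## References
* R. Teixeira da Costa, CMP 378 (2020) 705–781, arXiv:1910.02854, Theorem 4.1, §4. [Costa2019]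
-/

noncomputable section

namespace Literature.Geometry.Lorentzian.Kerr

/-- **Teixeira da Costa 2020, Theorem 4.1 (real-axis mode stability), subextremal case —
proved.** For `M > 0`, `|a| < M`, `s ∈ ½ℤ`, `m − s ∈ ℤ`, real `ω ≠ 0` and any real `λ`, every
classical solution of the homogeneous radial Teukolsky ODE on `(r₊, ∞)` which is outgoing at
`𝓗⁺` and at `𝓘⁺` vanishes identically. [cite: Costa2019, Theorem 4.1 and Theorem 1.1] -/
theorem Costa2019_realAxisModeStability_holds : Costa2019_realAxisModeStability := by
  intro M a s ω m lam hM ha h2s _ hω R hsol hH hI r hr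
  obtain ⟨k, hk⟩ := h2s
  rcases le_or_gt s 0 with hs | hs
  · exact Costa2019.modeStability_nonpos hM ha hs hk hω m lam hsol hH hI r hr
  · have hk0 : (0 : ℝ) < (k : ℝ) := by rw [← hk]; linarith
    have hk0' : 0 ≤ k := by exact_mod_cast hk0.le
    obtain ⟨n, hn⟩ : ∃ n : ℕ, (n : ℤ) = k := ⟨k.toNat, Int.toNat_of_nonneg hk0'⟩
    have hn' : (n : ℝ) = 2 * s := by
      rw [hk]
      exact_mod_cast hn
    refine Costa2019.modeStability_pos_of_nonpos hM ha hs hn' hω m lam hsol hH hI ?_ r hr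
    intro Q hQsol hQH hQI
    have hk' : 2 * (-s) = ((-k : ℤ) : ℝ) := by push_cast; linarith
    exact Costa2019.modeStability_nonpos hM ha (by linarith) hk' hω m (lam + 2 * s) hQsol hQH hQI

end Literature.Geometry.Lorentzian.Kerr

end
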